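import Literature.NumberTheory.EllipticCurves.TakahashiDegreeFormula
import Literature.NumberTheory.EllipticCurves.X1ElevenFiveIsogeny
import HarnessLib

/-!
# `stub_takahashi` · ideator k3 · gen 23 — FAMILY 3: the MINIMAL INSTANCE `N = 11`

Companion of `Cruxes/DefiniteRTControlPrime/STUB-IDEAS-stub_takahashi-3.md` (gen 23).
Crux `stmt-ABC-11338` = `DefiniteXi.DefiniteRTControlPrime`; registered stub (fixed, untouched):
`theorem stub_takahashi : takahashi2001_thm_2_3_of_coprime`.

Typed here (no `sorry`): the fact's body at fixed parameters (`TakahashiInstance`), the fact as the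
conjunction of its instances, the three ATOMS of the smallest non-vacuous instance
(`W = X1Eleven.curve11A1 = X₀(11)`, `(M, r) = (1, 11)`: `c₁₁ = 5`, `ξ_S = 5` in every setup,
`δ = 1`), the glue atoms ⇒ instance (`i := 5`, `j := 1`), and the converse showing that the
instance pins `δ ∈ {1, 25}` — so the `δ`-atom (the analytic modular degree of `X₀(11) → 11a1`,
for which the tree has no evaluator and no term of type `ModularParametrizationData _ _`) is what
blocks even this instance: no finite-range rung of the stub is kernel-certifiable.
-/

set_option linter.dupNamespace false

noncomputable section

namespace Summit.ABC.ABC.Cruxes.DefiniteRTControlPrime.StubIdeas3G23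

open Literature.NumberTheory.EllipticCurves Literature.NumberTheory.EllipticCurves.ModularForms
open Literature.NumberTheory.Automorphic
open Literature.NumberTheory.EllipticCurves.X1Eleven (curve11A1)

/-- H23.1 · the body of `takahashi2001_thm_2_3_of_coprime` at fixed `(W, M, r)`. -/
def TakahashiInstance (W : WeierstrassCurve ℚ) [W.IsElliptic] (M r : ℕ) [NeZero (M * r)] : Prop :=
  r.Prime → M.Coprime r → W.conductorNorm ℤ = M * r →
    ∀ P : ModularParametrizationData W (M * r),
      (∀ (W' : WeierstrassCurve ℚ) [W'.IsElliptic], W'.conductorNorm ℤ = M * r →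
          ∀ P' : ModularParametrizationData W' (M * r),
          P'.f = P.f → P.modularDegree ≤ P'.modularDegree) →
      ∀ S : Brandt.XiSetup M r,
        ∃ i j : ℕ, 0 < i ∧ i * j = (W.minimalDiscriminantNorm ℤ).factorization r ∧
          i ∣ S.xi (fun n => W.LFunction n) ∧
          P.modularDegree * i = S.xi (fun n => W.LFunction n) * j

/-- H23.1′ (PROVED) · the fact is exactly the conjunction of its instances. -/
theorem fact_iff_forall_instance :
    takahashi2001_thm_2_3_of_coprime ↔
      ∀ (W : WeierstrassCurve ℚ) [W.IsElliptic] (M r : ℕ) [NeZero (M * r)],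
        TakahashiInstance W M r :=
  Iff.rfl

/-- The level `1 · 11` is nonzero (scratch instance for the minimal example). -/
instance neZero_one_mul_eleven : NeZero (1 * 11) := ⟨by norm_num⟩

/-- H23.2a · atom (a): `c₁₁(11a1) = ord₁₁ Δ_min = 5` (`Δ = −11⁵`, globally minimal model;
in-tree reachable from `minimalDiscriminantNorm_eq_natAbs_holds` + `isGloballyMinimal_curve11A1`). -/
def AtomC11 : Prop := (curve11A1.minimalDiscriminantNorm ℤ).factorization 11 = 5

/-- H23.2b · atom (b): `ξ_S(a(11a1)) = 5` in EVERY Brandt setup of type `(1, 11)` (maximal orders of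
`B_{11,∞}`: `h = 2`, `w = (2, 3)`, `g = e₁ − e₂`, `ξ = 2 + 3`); needs the in-Lean classification of
maximal orders / right-ideal classes of `B_{11,∞}` — no evaluator for the abstract `XiSetup`. -/
def AtomXi11 : Prop := ∀ S : Brandt.XiSetup 1 11, S.xi (fun n => curve11A1.LFunction n) = 5

/-- H23.2c · atom (c): the conductor-restricted-minimal parametrisation degree of `11a1` at level
`11` is `1` ("`X₀(11) = 11a1`, Manin constant `±1`"): the analytic modular degree — NO evaluator,
no term of type `ModularParametrizationData _ _` anywhere in the tree. -/
def AtomDeg11 : Prop :=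
  ∀ P : ModularParametrizationData curve11A1 (1 * 11),
    (∀ (W' : WeierstrassCurve ℚ) [W'.IsElliptic], W'.conductorNorm ℤ = 1 * 11 →
        ∀ P' : ModularParametrizationData W' (1 * 11),
        P'.f = P.f → P.modularDegree ≤ P'.modularDegree) →
    P.modularDegree = 1

/-- H23.3 (PROVED) · atoms ⇒ the minimal instance, with `(i, j) = (5, 1)`. -/
theorem instance11_of_atoms (hc : AtomC11) (hξ : AtomXi11) (hδ : AtomDeg11) :
    TakahashiInstance curve11A1 1 11 := by
  intro _ _ _ P hmin S
  refine ⟨5, 1, by norm_num, ?_, ?_, ?_⟩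
  · rw [hc]
  · rw [hξ S]
  · rw [hξ S, hδ P hmin]

/-- H23.4 (PROVED) · conversely, given atoms (a), (b), the instance pins the optimal degree to
`δ ∈ {1, 25}` (`i j = 5`, `δ i = 5 j`): the `δ`-atom cannot be bypassed. -/
theorem deg_mem_of_instance11 (h : TakahashiInstance curve11A1 1 11) (hc : AtomC11) (hξ : AtomXi11)
    (hN : curve11A1.conductorNorm ℤ = 1 * 11)
    (P : ModularParametrizationData curve11A1 (1 * 11))
    (hmin : ∀ (W' : WeierstrassCurve ℚ) [W'.IsElliptic], W'.conductorNorm ℤ = 1 * 11 →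
        ∀ P' : ModularParametrizationData W' (1 * 11),
        P'.f = P.f → P.modularDegree ≤ P'.modularDegree)
    (S : Brandt.XiSetup 1 11) :
    P.modularDegree = 1 ∨ P.modularDegree = 25 := by
  obtain ⟨i, j, hi, hij, -, hδ⟩ :=
    h (by norm_num) (Nat.coprime_one_left 11) hN P hmin S
  rw [hc] at hij
  rw [hξ S] at hδ
  have hi5 : i ∣ 5 := Dvd.intro j hij
  have hcases : i = 1 ∨ i = 5 := (Nat.dvd_prime (by norm_num)).mp hi5
  rcases hcases with rfl | rfl
  · right; omega
  · left; omega

end Summit.ABC.ABC.Cruxes.DefiniteRTControlPrime.StubIdeas3G23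

end
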